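import Summits.ResolutionOfSingularities.ResolutionOfSingularities.Theorems.WeightedInvariantContactCentreFiltration
import Mathlib.RingTheory.Spectrum.Prime.Basic
import HarnessLib

/-!
# The cylinder construction `jCylinder ι J` — the centre filtration READ AT THE GENERIC POINT OF THE TOP `ι`-STRATUM
# (door `HypersurfaceCentreConstruction`, stmt-ResolutionOfSingularities-19897; KEY `stub_localWeightedDropEFT4S`, regime P3 =
# the third rung `PRung 3` of res-type-061's ladder p522114; res-type-005, ORDER (o28) res-L1-w43-plan-1 2026-08-27T09:31:23Z,
# design note 10:28:22Z)

Topic: `Summits/ResolutionOfSingularities/ResolutionOfSingularities/Theorems`. DEFINITIONS posited by the route `WeightedInvariant`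
for the door item `HypersurfaceCentreConstruction` (stmt-ResolutionOfSingularities-19897) — objects OF THE LINE, not cited
statements: given a local invariant `ι : (R : Type) → [CommRing R] → R → Ordinal` and a centre filtration
`J : (R : Type) → [CommRing R] → R → ℕ → Ideal R` (the binder shapes of the clauses `IotaJEssSmoothCompatible`,
`CanonicalGameClause`, … of `…LocalGameEFT3`), the CYLINDER `jCylinder ι J R f m` reads `J` at the generic point `P` of the top
`ι`-stratum through the closed point — `(J (R_P) (f/1) m) ∩ R` — whenever that stratum is irreducible (`P` prime), and is `⊤`
(junk) otherwise.  With `J := jContact` (res-type-092's P2 centre filtration, p514802) this is the P3 candidate «cylinder rule» of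
the (o28) probe (value / compatibility / presentation / openness: p522408 (res-D-brk-1), p521270, p521958, p522933); the (open″)
conjunct «`V(U) =` the `ι`-equimultiple locus» forces the stratum to be the `ι`-stratum of the FULL invariant, whence the
parameter `ι`.  No instance, no notation; unfolding lemmas only.  [OURS · L1 W4.3 · (o28) design (D1)]  Replaces the role of NO
printed item; NOT a statement of the manuscript [claim: Hironaka2017, status: under-review]. AI work, weaker than expert review.

## References

* V. Cossart, U. Jannsen, S. Saito, LNM 2270 (2020), Ch. 8 (maximal contact, the directrix and permissible curves for surfaces).
  [CossartJannsenSaito2020]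
* H. Matsumura, Commutative Ring Theory (1987), §4 (localisation at a prime). [Matsumura1987]
-/

noncomputable section

open IsLocalRing

set_option linter.dupNamespace false -- mandated namespace of this single-conjunct summit

namespace Summit.ResolutionOfSingularities.ResolutionOfSingularities.Theorems

namespace ContactCylinder

/-- [OURS · (o28) (D1)] **The top `ι`-stratum through the closed point**, as a set of points of `Spec R`: the primes `𝔮` at
which `ι` (read in `R_𝔮`) takes the same value as at `R` itself.  For an invariant that does not increase under generisation
this is the locus where `ι` is maximal; a predicate of the line, not a cited statement. -/
def topStratum (ι : (R : Type) → [CommRing R] → R → Ordinal.{0}) (R : Type) [CommRing R] (f : R) :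
    Set (PrimeSpectrum R) :=
  {𝔮 | ι (Localization.AtPrime 𝔮.asIdeal) (algebraMap R (Localization.AtPrime 𝔮.asIdeal) f) = ι R f}

/-- [OURS · (o28) (D1)] **The generic prime of the top `ι`-stratum**: the intersection of the primes of `topStratum ι R f`
(the radical of the stratum ideal when the stratum is closed; PRIME exactly when the stratum is irreducible — regimes P≤2
and P3a; `⊤` when the stratum is empty). -/
def topStratumPrime (ι : (R : Type) → [CommRing R] → R → Ordinal.{0}) (R : Type) [CommRing R] (f : R) : Ideal R :=
  ⨅ 𝔮 ∈ topStratum ι R f, 𝔮.asIdeal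

/-- [OURS · (o28) (D1)] **The cylinder over a prime**: `J` read in the localisation `R_P` and contracted back to `R`,
`cylinderAt J R P f m = (J (R_P) (f/1) m) ∩ R`. -/
def cylinderAt (J : (R : Type) → [CommRing R] → R → ℕ → Ideal R) (R : Type) [CommRing R] (P : Ideal R) [P.IsPrime]
    (f : R) (m : ℕ) : Ideal R :=
  (J (Localization.AtPrime P) (algebraMap R (Localization.AtPrime P) f) m).comap (algebraMap R (Localization.AtPrime P))

open Classical in
/-- [OURS · (o28) (D1) · candidate] **THE CYLINDER CONSTRUCTION `jCylinder ι J`** in the binder shape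
`(R : Type) → [CommRing R] → R → ℕ → Ideal R` of the clauses: the centre filtration `J` READ AT THE GENERIC POINT of the top
`ι`-stratum through the closed point — `cylinderAt J R P f m` for `P = topStratumPrime ι R f` when `P` is prime, `⊤` (junk)
otherwise.  The P3 candidate pair of record is `(ι₃, jCylinder ι₃ jContact)`; NOT claimed to serve beyond regime P3a
(reducible top strata). -/
def jCylinder (ι : (R : Type) → [CommRing R] → R → Ordinal.{0}) (J : (R : Type) → [CommRing R] → R → ℕ → Ideal R)
    (R : Type) [CommRing R] (f : R) (m : ℕ) : Ideal R :=
  if h : (topStratumPrime ι R f).IsPrime then @cylinderAt J R _ (topStratumPrime ι R f) h f m else ⊤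

/-! ## Unfolding lemmas -/

/-- Membership in the top stratum, unfolded. [folklore] -/
theorem mem_topStratum_iff (ι : (R : Type) → [CommRing R] → R → Ordinal.{0}) (R : Type) [CommRing R] (f : R)
    (𝔮 : PrimeSpectrum R) :
    𝔮 ∈ topStratum ι R f ↔
      ι (Localization.AtPrime 𝔮.asIdeal) (algebraMap R (Localization.AtPrime 𝔮.asIdeal) f) = ι R f :=
  Iff.rfl

/-- The generic prime lies below every prime of the stratum. [folklore] -/
theorem topStratumPrime_le (ι : (R : Type) → [CommRing R] → R → Ordinal.{0}) (R : Type) [CommRing R] (f : R)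
    {𝔮 : PrimeSpectrum R} (h𝔮 : 𝔮 ∈ topStratum ι R f) : topStratumPrime ι R f ≤ 𝔮.asIdeal :=
  (iInf_le _ 𝔮).trans (iInf_le _ h𝔮)

/-- A prime below every prime of the stratum lies below the generic prime. [folklore] -/
theorem le_topStratumPrime (ι : (R : Type) → [CommRing R] → R → Ordinal.{0}) (R : Type) [CommRing R] (f : R)
    {P : Ideal R} (hP : ∀ 𝔮 ∈ topStratum ι R f, P ≤ 𝔮.asIdeal) : P ≤ topStratumPrime ι R f :=
  le_iInf fun 𝔮 => le_iInf fun h𝔮 => hP 𝔮 h𝔮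

/-- **When the top stratum is the closed set `V(P)` of a prime `P`, its generic prime is `P`.** [folklore] -/
theorem topStratumPrime_eq_of_topStratum_eq (ι : (R : Type) → [CommRing R] → R → Ordinal.{0}) (R : Type) [CommRing R]
    (f : R) {P : Ideal R} [hP : P.IsPrime] (hE : topStratum ι R f = {𝔮 | P ≤ 𝔮.asIdeal}) :
    topStratumPrime ι R f = P := by
  apply le_antisymm
  · exact topStratumPrime_le ι R f (𝔮 := ⟨P, hP⟩) (by rw [hE]; exact (le_rfl : P ≤ P))
  · exact le_topStratumPrime ι R f fun 𝔮 h𝔮 => by rw [hE] at h𝔮; exact h𝔮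

/-- The cylinder over a prime, unfolded. [folklore] -/
theorem cylinderAt_def (J : (R : Type) → [CommRing R] → R → ℕ → Ideal R) (R : Type) [CommRing R] (P : Ideal R)
    [P.IsPrime] (f : R) (m : ℕ) :
    cylinderAt J R P f m =
      (J (Localization.AtPrime P) (algebraMap R (Localization.AtPrime P) f) m).comap
        (algebraMap R (Localization.AtPrime P)) :=
  rfl

/-- On an irreducible top stratum `jCylinder ι J R f m` is the cylinder over its generic prime. [folklore] -/
theorem jCylinder_eq_cylinderAt (ι : (R : Type) → [CommRing R] → R → Ordinal.{0})
    (J : (R : Type) → [CommRing R] → R → ℕ → Ideal R) (R : Type) [CommRing R] (f : R) (m : ℕ)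
    [h : (topStratumPrime ι R f).IsPrime] :
    jCylinder ι J R f m = cylinderAt J R (topStratumPrime ι R f) f m := by
  unfold jCylinder
  rw [dif_pos h]

/-- Off the irreducible strata `jCylinder ι J R f m = ⊤` (junk). [folklore] -/
theorem jCylinder_of_not_isPrime (ι : (R : Type) → [CommRing R] → R → Ordinal.{0})
    (J : (R : Type) → [CommRing R] → R → ℕ → Ideal R) (R : Type) [CommRing R] (f : R) (m : ℕ)
    (h : ¬ (topStratumPrime ι R f).IsPrime) : jCylinder ι J R f m = ⊤ := by
  unfold jCylinder
  rw [dif_neg h]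

/-- **The cylinder value when the top stratum is `V(P)`**: `jCylinder ι J R f m = (J (R_P) (f/1) m) ∩ R`. [folklore] -/
theorem jCylinder_eq_of_topStratum_eq (ι : (R : Type) → [CommRing R] → R → Ordinal.{0})
    (J : (R : Type) → [CommRing R] → R → ℕ → Ideal R) (R : Type) [CommRing R] (f : R) (m : ℕ) {P : Ideal R}
    [hP : P.IsPrime] (hE : topStratum ι R f = {𝔮 | P ≤ 𝔮.asIdeal}) :
    jCylinder ι J R f m =
      (J (Localization.AtPrime P) (algebraMap R (Localization.AtPrime P) f) m).comap
        (algebraMap R (Localization.AtPrime P)) := by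
  have hPeq : topStratumPrime ι R f = P := topStratumPrime_eq_of_topStratum_eq ι R f hE
  haveI : (topStratumPrime ι R f).IsPrime := hPeq ▸ hP
  rw [jCylinder_eq_cylinderAt, cylinderAt_def]
  subst hPeq
  rfl

end ContactCylinder

end Summit.ResolutionOfSingularities.ResolutionOfSingularities.Theorems

end
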